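import Summits.RiemannHypothesis.RiemannHypothesis.Theses.WeilWindowFlow
import Summits.RiemannHypothesis.RiemannHypothesis.Theorems.WeilWindowFlowStrictUnderRHJensen
import Summits.RiemannHypothesis.RiemannHypothesis.Theorems.WeilWindowFlowStrictUnderRHCounting
import Summits.RiemannHypothesis.RiemannHypothesis.Theorems.WeilWindowFlowStrictUnderRHZeroSide
import Literature.NumberTheory.LFunctions.WeilSemilocalCompactnessProofs

/-!
# `StrictUnderRH`: under RH the bottom of the truncated Weil form is strictly positive

Item stmt-RiemannHypothesis-1043 of route WeilWindowFlow (support / calibration):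
`Summit.RiemannHypothesis → ∀ a > 0, 0 < ε(a)`, `ε(a) = weilGroundEnergy a` the infimum of
`Re Q(g) = Re W(g ⋆ g̃)` over `L²`-normalised test functions supported in `[-a, a]`.

## Proof (attainment + uniqueness set; all inputs are proved tree theorems)

Suppose RH and `ε(a) ≤ 0` for some `a > 0`.
1. A ground state exists: `u ∈ L²`, `‖u‖₂ = 1`, `u = lim gₙ` in `L²` for a normalised minimising
   sequence of window test functions (`ConnesConsaniMoscovici2025_thm_3_6_holds`, the compactness
   of the form embedding, Connes–Consani–Moscovici 2025 Thm. 3.6 / Bombieri 2000 Thm. 3).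
2. By the explicit formula under RH, `m(ρ)|ĝₙ(ρ)|² ≤ Re Q(gₙ) → ε(a) ≤ 0` for every non-trivial
   zero `ρ`, and `ĝₙ(ρ) → û(ρ)`; so `û` vanishes at every non-trivial zero
   (`weilMellin_groundState_eq_zero`).
3. `F(z) = û(1/2 + iz)` is entire of exponential type `a`, and `F ≢ 0` on `ℝ` (`L¹` Fourier
   uniqueness); by Jensen's inequality its real zeros in `[c - r, c + r]` number at most
   `(2a/log 2) r + O(1)` (`card_real_zeros_le`).
4. Under RH the distinct ordinates `0 < γ ≤ T` number at least `A·T` for any `A`, for suitable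
   large `T` (Riemann–von Mangoldt and the Goldston–Gonek multiplicity bound `m(ρ) = o(log γ)`;
   `exists_card_ordinates_ge`). With `A = 2a/log 2 + 1` this contradicts 3.

This replaces the sampling-set route suggested in the item text (Beurling / Ortega-Cerdà–Seip)
by the "attainment + uniqueness sets" alternative also named there (Bombieri 2000 Thm. 3).

## References

* E. Bombieri, Rend. Mat. Acc. Lincei (9) 11 (2000), §3 (3.2), §4 Thm. 3.
* A. Connes, C. Consani, H. Moscovici, arXiv:2511.22755, Thm. 3.6.
* M. Balazard, A. de Roton, arXiv:0810.3587, Prop. 16 (Goldston–Gonek).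
* E. C. Titchmarsh, *The Theory of the Riemann Zeta-Function*, Thm. 9.4.
-/

-- `Summit.RiemannHypothesis.RiemannHypothesis.…` repeats a namespace component by design (D-0017 layout).
set_option linter.dupNamespace false

noncomputable section

open Complex Filter Set MeasureTheory
open scoped Real Topology

namespace Summit.RiemannHypothesis.RiemannHypothesis.Theorems

open Literature.NumberTheory.LFunctions WeilWindowFlowStrictUnderRH

/-- **`StrictUnderRH` (item stmt-RiemannHypothesis-1043, route WeilWindowFlow).** Under the
Riemann hypothesis the bottom `ε(a) = weilGroundEnergy a` of Weil's quadratic form on the window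
`[-a, a]` is strictly positive for every `a > 0`. Proof: module docstring (ground state by
compactness; the explicit formula kills `û` at every zero of `ζ`; Jensen versus the superlinear
count of distinct ordinates under RH). [folklore] -/
theorem strictUnderRH_proof :
    Summit.RiemannHypothesis.RiemannHypothesis.Theses.WeilWindowFlow.StrictUnderRH := by
  unfold Summit.RiemannHypothesis.RiemannHypothesis.Theses.WeilWindowFlow.StrictUnderRH
  intro hRH' a ha
  have hRH : _root_.RiemannHypothesis := (_root_.Summit.RiemannHypothesis_iff).1 hRH'
  by_contra hle
  push Not at hle
  -- 1. a ground state
  obtain ⟨u, hu⟩ := ConnesConsaniMoscovici2025_thm_3_6_holds.exists_isWeilGroundState ha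
  -- 3. the entire function `F(z) = û(1/2 + iz)`: type `a`, not identically zero
  set F : ℂ → ℂ := fun z ↦ weilMellin u (1 / 2 + z * I) with hFdef
  have hFd : Differentiable ℂ F := hu.differentiable_weilMellin.comp (by fun_prop)
  obtain ⟨c, hc⟩ := exists_weilMellin_half_line_ne_zero hu
  have hFc : F c ≠ 0 := hc
  set K : ℝ := max 1 (∫ t, ‖u t‖) with hKdef
  have hK : 1 ≤ K := le_max_left _ _
  have hbound : ∀ z : ℂ, ‖F z‖ ≤ K * Real.exp (a * |z.im|) := fun z ↦
    norm_weilMellin_half_add_le hu z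
  -- 2. `F` vanishes at the ordinates of the zeros of `ζ`
  have hzero : ∀ γ : ℝ, 0 < γ → riemannZeta (1 / 2 + (γ : ℂ) * I) = 0 → F γ = 0 := by
    intro γ hγ hζ
    refine weilMellin_groundState_eq_zero hRH hu hle hζ ?_
    simp [hγ.ne']
  -- 4. many distinct ordinates
  set C₀ : ℝ := (Real.log K + a * (2 * |c|) - Real.log ‖F c‖) / Real.log 2 with hC₀
  set A : ℝ := 2 * a / Real.log 2 + 1 with hA
  obtain ⟨T, hT, S, hS, hcard⟩ := exists_card_ordinates_ge hRH A (max (C₀ + 1) 1)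
  have hT1 : 1 ≤ T := (le_max_right _ _).trans hT
  have hTC : C₀ + 1 ≤ T := (le_max_left _ _).trans hT
  -- Jensen on `[c - r, c + r]`, `r = T + |c|`
  have hr : 0 < T + |c| := by positivity
  have hS' : ∀ x ∈ S, |x - c| ≤ T + |c| ∧ F x = 0 := by
    intro x hx
    obtain ⟨hx0, hxT, hζ⟩ := hS x hx
    refine ⟨?_, hzero x hx0 hζ⟩
    calc |x - c| ≤ |x| + |c| := abs_sub _ _
      _ ≤ T + |c| := by rw [abs_of_pos hx0]; linarith
  have hJ := card_real_zeros_le hFd hFc hK ha.le hbound hr S hS'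
  have hlog2 : 0 < Real.log 2 := Real.log_pos one_lt_two
  have hJ' : (S.card : ℝ) ≤ 2 * a / Real.log 2 * T + C₀ := by
    rw [hC₀]
    have h : (Real.log K + a * (2 * (T + |c|)) - Real.log ‖F c‖) / Real.log 2 =
        2 * a / Real.log 2 * T + (Real.log K + a * (2 * |c|) - Real.log ‖F c‖) / Real.log 2 := by
      field_simp
      ring
    linarith [h]
  -- contradiction
  have hAT : A * T = 2 * a / Real.log 2 * T + T := by rw [hA]; ring
  linarith

end Summit.RiemannHypothesis.RiemannHypothesis.Theorems

end
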